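import Summits.Ventures.PercRepro.RankLevelSetExplicitLin2KeyL

/-!
# PercRepro — THE LEVEL-13 THEOREM-M ROW OF C-025: THE KEY AT `p = 9 286` (p4, S4 feed)

`proofs/P4-gen18.md`. With THEOREM M's staircase multiplicity the assembled inequality `(P_d)` holds, exactly evaluated, at EVERY
core corank `14 ≤ d ≤ 8205` from `p = 2 992` (it fails at `p = 2 991`, corank `2 582`; the quartic floor is `17 876`, the
saturated one `85 609`). The row is taken at `p = 9 286` = the Chernoff tail `⌈(9(13 + 2^13) + 17·13 + 216)/8⌉` of
RankLevelSetExplicitLin2LevelTail, which now binds: the key `KeyL 13 9286 d` (RankLevelSetExplicitLin2KeyL) is checked by the kernel at the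
8 192 coranks (`decide`, 2 chunks of 4 096). The level step and the unconditional chain are
RankLevelSetExplicitLin2IndepFloor (`c025_thirteen_indep_step`, `c025_thirteen_indep_from_9286`). Axioms: standard.
-/

namespace PercRepro

namespace ThmN

namespace Explicit

/-- The THEOREM-M key row at `(q, p) = (13, 9 286)`, chunk 1 of 2: coranks `14 … 4109`, by the kernel. -/
theorem key_thirteen_indep_row_1 : ∀ t < 4096, KeyL 13 9286 (14 + t) := by decide +kernel

/-- The THEOREM-M key row at `(q, p) = (13, 9 286)`, chunk 2 of 2: coranks `4110 … 8205`, by the kernel. -/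
theorem key_thirteen_indep_row_2 : ∀ t < 4096, KeyL 13 9286 (14 + (4096 + t)) := by decide +kernel

/-- **THE THEOREM-M KEY ROW AT `(q, p) = (13, 9 286)`**: `KeyL 13 9286 d` at every corank `14 ≤ d ≤ 8205` (the 2 chunks). -/
theorem key_thirteen_indep_row : ∀ t < 8192, KeyL 13 9286 (14 + t) :=
  ball_lt_add (fun t => KeyL 13 9286 (14 + t)) 4096 4096
    (key_thirteen_indep_row_1) key_thirteen_indep_row_2

/-- **THE KEY'S OWN FLOOR IS `2 992`**: the THEOREM-M key FAILS at `p = 2 991`, corank `2 582`, by the kernel (the row sits at the tail `9 286`). -/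
theorem key_thirteen_indep_sharp : ¬ KeyL 13 2991 2582 := by decide +kernel

end Explicit

end ThmN

end PercRepro
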